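import Summits.QuantumFields.YangMills.Theorems.BackwardLiouvilleRigidityFlatRatioTermination
import HarnessLib

/-!
# Crux `FluctuationComparisonRegPrIntL` (stmt-QuantumFields-20520), LINE «run-pair organ» (ym-r3-idea-1 g14) —
registered stub `stub_innerWindowChains` (S4a), BY NAME

The skeleton `Cruxes/FluctuationComparisonRegPrIntL/Lines/runpair_organ.lean` declares S4a `InnerWindowChains` «= the derived theorem
`innerWindowChains` of `Lines/flat_ratio_termination.lean`, BY STATEMENT».  That statement is NOW A TREE THEOREM for the termination line
of route `BackwardLiouvilleRigidity`: `Summit.QuantumFields.YangMills.Theorems.FlatRatioTermination.innerWindowChains` (composition of the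
landed `stub_innerWindowGaugeSmall` p679507 — the volume-uniform small `SU(2)` gauge —, `stub_thresholds` p652443 and `stub_gaugeSmallChains`
p651934).  This file reproduces the skeleton's Prop `InnerWindowChains` verbatim (definitionally equal to the registered one) and discharges the
registered stub by that theorem — the pattern of S4b (p671363) and S4c (p670105).  Cell `ym-idea-1` width seat `ym-line-sfw-p2-w3` g31 (free
hands, R3 family).  HONEST FRAMING: the line's content stubs S1a/S1b/S2/S3 are untouched; no organ, crux, rung or summit is proved;
`YM3TorusSU2` and the Yang–Mills mass gap are NOT proved.
-/

set_option autoImplicit false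

open MeasureTheory Filter Topology
open Literature.MathematicalPhysics.QuantumFieldTheory.Balaban1983to89 T3ContinuumYM3Torus T3NestedUnitLaws
  T3UnitLawDensityEML T4Continuum BalabanUVClass T3UnitScaleTilt

namespace Summit.QuantumFields.YangMills.Theorems.FluctuationComparisonRegPrIntL.RunPairOrgan

/-- The skeleton's Prop `InnerWindowChains` (S4a, verbatim copy of
`Summit.QuantumFields.YangMills.Cruxes.FluctuationComparisonRegPrIntL.RunPairOrgan.InnerWindowChains`, definitionally equal): every
configuration of the inner window `θBal F.L γ (√b₀) (p₀/2) j` is joined to `1` by `≤ #PBond_j²` one-bond moves inside the window. -/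
def InnerWindowChains : Prop :=
  ∃ pW : ℝ, ∀ (p₀ : ℝ), pW ≤ p₀ → ∀ (F : T3Family) (γ b₀ : ℝ), 0 < γ → γ ≤ 1 → 0 < b₀ → ∃ jW : ℕ, ∀ j : ℕ, jW ≤ j → (∀ U : GaugeField (F.P j) 0 ↥(Matrix.specialUnitaryGroup (Fin 2) ℂ), PlaqSmall (θBal F.L γ (Real.sqrt b₀) (p₀ / 2) j) U → ∃ (n : ℕ) (W : ℕ → GaugeField (F.P j) 0 ↥(Matrix.specialUnitaryGroup (Fin 2) ℂ)), n ≤ Fintype.card (PBond (F.P j) 0) ^ 2 ∧ (∀ e, W 0 e = 1) ∧ W n = U ∧ (∀ i, i ≤ n → PlaqSmall (θBal F.L γ b₀ p₀ j) (W i)) ∧ (∀ i, i < n → ∃ b : PBond (F.P j) 0, ∀ e, e ≠ b → W i e = W (i + 1) e))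

/-- Registered stub `stub_innerWindowChains` of LINE «run-pair organ» (header verbatim = the skeleton's), discharged by the
termination-line theorem `FlatRatioTermination.innerWindowChains` — the two statements coincide. -/
theorem stub_innerWindowChains : InnerWindowChains :=
  Summit.QuantumFields.YangMills.Theorems.FlatRatioTermination.innerWindowChains

end Summit.QuantumFields.YangMills.Theorems.FluctuationComparisonRegPrIntL.RunPairOrgan
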